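import Summits.ABC.StewartYu.KummerThirdDoor
import Summits.ABC.StewartYu.Y07OfYu2007
import HarnessLib

/-!
# Cell abc-stewartyu, M3: end-to-end wiring check of the Kummer door — the named fact `yu2007_padicLogForm_rat`
# gives `BakerMethodBounds` THROUGH THE PRIME TEXTS

`Summits/ABC/StewartYu/KummerThirdSanity.lean` — cell `abc-stewartyu` (seat p3; one theorem, no named fact minted).
Integration test of the staged rung route `PadicPrimesKummerThird` (F-A1 = Stewart–Yu 2001): lit's dossier theorems
`Y07.y07Odd_of_yu2007` / `Y07.y07Two_of_yu2007` (the named fact `Literature.Barriers.ABC.yu2007_padicLogForm_rat` implies the two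
crux texts, p448111) composed with p3's door `KummerThird.BakerMethodBounds_of_y07` (the two texts imply the barrier declaration,
p448673) yield `yu2007_padicLogForm_rat → BakerMethodBounds` by a route that touches ONLY `p`-adic bounds for rational primes —
so the route's items are wired consistently (texts byte-compatible across the three seats' files) and the tree's direct door
`BakerMethodBounds_of_yu_kummerArchBound₂` has a primes-only twin.  CONDITIONAL on the named fact (nothing new is claimed
unconditionally); its value is the kernel check of the composition. [folklore]
-/

namespace Summit.ABC.StewartYu.KummerThird

/-- **Wiring check (conditional on the named fact)**: Yu 2007 for rationals ⇒ the prime texts `Y07Odd`, `Y07Two`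
(lit) ⇒ `BakerMethodBounds` (p3's Kummer door). [folklore] -/
theorem bakerMethodBounds_of_yu2007_via_primes (h : Literature.Barriers.ABC.yu2007_padicLogForm_rat) :
    Literature.Barriers.ABC.BakerMethodBounds :=
  BakerMethodBounds_of_y07 (Y07.y07Odd_of_yu2007 h) (Y07.y07Two_of_yu2007 h)

end Summit.ABC.StewartYu.KummerThird
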